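import Summits.BirchSwinnertonDyer.BirchSwinnertonDyer.Theorems.ClassRecordThreeEulerHalvesAtThreeCartanCoverInertHecke
import HarnessLib

/-!
# Unipotent Fourier rigidity in `GL₂(𝔽_q)` — §A.1–§A.4 of the `doublecoset` certificate for crux 24801 `CartanOnePlaceDegreeLawAtThree`

Lift-only port (cell bsd-stepL, SUMMON key `k5-lift1`, director-bsd (734)(1) CONCUR 2026-08-31) of §A.1–§A.4 (source lines 119–391) of the crux-ideate workfile
`Summits/BirchSwinnertonDyer/BirchSwinnertonDyer/Cruxes/CartanOnePlaceDegreeLawAtThree/Lines/doublecoset.lean` (lineage `cruxidea-stmt-BirchSwinnertonDyer-24801-1`, generation 22,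
commit 721e9ccbdf4b, sha256-16 d3adee7328f6a76c, 2876 l.; farm rc 0, sorries 4 = its §4 stubs, none of which is lifted; referee landing record `VERDICT-DOUBLECOSET-G22-g88.md`).
Declarations, statements and proofs below are BYTE-IDENTICAL to the source; the only edits are the namespace (`…Cruxes.CartanOnePlaceDegreeLawAtThree.Doublecoset` ↦
`…Theorems.CartanDoubleCoset`, shared by the nine `ClassRecordThreeCartanSupply*` modules), the imports ∕ `open`s each module needs, and one-line docstrings added where the source
had none. Nothing is re-stated, weakened or re-proved.

CONTENT (finite group theory of `GL₂(𝔽_q)`, any prime `q`; no curve, no modular form). §A.1 explicit elements: the diagonal `h(c) = diagU c`, the Weyl element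
`weylP`, their products with the tree's unipotents `upperUnip` ∕ `lowerUnip` (`CartanCover.Charext.InertHecke`), `diag_decomp`. §A.2 Fourier analysis along the unipotent
radical `N ≅ ℤ∕q`: the standard additive character `ψq`, the (q-fold) Fourier projectors `four ρ j = Σ_x ψ(−jx) ρ(n(x))`, orthogonality `four_four`, completeness
`sum_four`, and the diagonal torus permuting the projectors (`diagU_four`). §A.3 LEMMA A `unip_trivial_of_noSplitFixed` (unipotent rigidity): a `G`-stable subspace with
scalars acting trivially and no diagonal-torus-fixed vector is `N`-trivial. §A.4 LEMMA B `mem_fixer_of_det_one` (normal closure): the pointwise `fixer` of a `G`-stable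
subspace contains `SL₂(𝔽_q)` once it contains `N` (four-unipotent factorisation `exists_unip_factorization` of the tree). Consumed by `sphericalTransfer` ((SPH), module
`ClassRecordThreeCartanSupplySphericalLeaves`) and by the cubic character tables (`ClassRecordThreeCartanSupplyCubicCharacterTables`).

HONEST: a `--supports stmt-BirchSwinnertonDyer-24801` helper module; it proves NOTHING about NUM ∕ NUM♮ (items 24801 ∕ 32276) or crux 19109 for any curve — the leaves (MO1)
`SplitLevelMultiplicityOne`, (BCV) `BorelCubicEigenDocking`, (VAN) `NonsplitTorusCubicVanishing`, (DS) ∧ (JLᶜ) stay OPEN; registry `Lines/petarea.lean` rev 8 untouched; BSD is proved for no curve.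
-/

set_option linter.dupNamespace false  -- `Summit.BirchSwinnertonDyer.BirchSwinnertonDyer.…` (summit = problem), as every file of this directory
set_option autoImplicit false

noncomputable section

open scoped Classical MatrixGroups
open Matrix

namespace Summit.BirchSwinnertonDyer.BirchSwinnertonDyer.Theorems.CartanDoubleCoset

open Summit.BirchSwinnertonDyer.BirchSwinnertonDyer.Theorems
open Summit.BirchSwinnertonDyer.BirchSwinnertonDyer.Theorems.CartanCover.Charext.InertHecke (upperUnip lowerUnip coe_upperUnip coe_lowerUnip upperUnip_mul upperUnip_zero exists_unip_factorization)

/-! ## §A PROVED: (SPH) — the spherical transfer, by unipotent Fourier rigidity (finite group theory of `GL₂(𝔽_q)`, any prime `q`) -/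

section FiniteGroup

variable {q : ℕ} [Fact q.Prime]

/-! ### §A.1 Explicit elements of `GL₂(𝔽_q)`: the tree's unipotents `upperUnip`∕`lowerUnip` (`CartanCover.Charext.InertHecke`), the diagonal `h(c)` and the Weyl element -/

/-- the diagonal element `h(c) = diag(c, 1)`. -/
def diagU (c : (ZMod q)ˣ) : GL (Fin 2) (ZMod q) :=
  Matrix.GeneralLinearGroup.mkOfDetNeZero !![(c : ZMod q), 0; 0, 1] (by simp [Matrix.det_fin_two_of])

/-- the Weyl element `P = (0 1; 1 0)`. -/
def weylP : GL (Fin 2) (ZMod q) :=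
  Matrix.GeneralLinearGroup.mkOfDetNeZero !![0, 1; 1, 0] (by simp [Matrix.det_fin_two_of])

/-- the matrix of `h(c)`. -/
@[simp] theorem coe_diagU (c : (ZMod q)ˣ) :
    ((diagU c : GL (Fin 2) (ZMod q)) : Matrix (Fin 2) (Fin 2) (ZMod q)) = !![(c : ZMod q), 0; 0, 1] := rfl

/-- the matrix of the Weyl element `P`. -/
@[simp] theorem coe_weylP :
    ((weylP : GL (Fin 2) (ZMod q)) : Matrix (Fin 2) (Fin 2) (ZMod q)) = !![0, 1; 1, 0] := rfl

/-- `h(a) h(b) = h(ab)`. -/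
theorem diagU_mul (a b : (ZMod q)ˣ) : diagU a * diagU b = diagU (a * b) := by
  apply Units.ext
  rw [Units.val_mul, coe_diagU, coe_diagU, coe_diagU]
  ext i j
  fin_cases i <;> fin_cases j <;> simp [Matrix.mul_apply, Fin.sum_univ_two]

/-- `h(1) = 1`. -/
@[simp] theorem diagU_one : (diagU 1 : GL (Fin 2) (ZMod q)) = 1 := by
  apply Units.ext
  rw [coe_diagU, Units.val_one]
  ext i j
  fin_cases i <;> fin_cases j <;> simp

/-- `h(a)⁻¹ = h(a⁻¹)`. -/
theorem diagU_inv (a : (ZMod q)ˣ) : (diagU a)⁻¹ = diagU a⁻¹ :=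
  inv_eq_of_mul_eq_one_right (by rw [diagU_mul, mul_inv_cancel, diagU_one])

/-- `h(c) n(x) = n(c x) h(c)`. -/
theorem diagU_mul_unip (c : (ZMod q)ˣ) (x : ZMod q) : diagU c * upperUnip x = upperUnip ((c : ZMod q) * x) * diagU c := by
  apply Units.ext
  simp only [Units.val_mul, coe_diagU, coe_upperUnip]
  ext i j
  fin_cases i <;> fin_cases j <;> simp [Matrix.mul_apply, Fin.sum_univ_two]

/-- `P n(x) = n⁻(x) P`. -/
theorem weylP_mul_unip (x : ZMod q) : weylP * upperUnip x = lowerUnip x * weylP := by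
  apply Units.ext
  simp only [Units.val_mul, coe_weylP, coe_upperUnip, coe_lowerUnip]
  ext i j
  fin_cases i <;> fin_cases j <;> simp [Matrix.mul_apply, Fin.sum_univ_two]

/-- `n⁻(x) = P n(x) P⁻¹`. -/
theorem lowp_eq_conj (x : ZMod q) : lowerUnip x = weylP * upperUnip x * weylP⁻¹ := by
  rw [weylP_mul_unip, mul_inv_cancel_right]

/-- the determinant of an element of `GL₂(𝔽_q)` is non-zero. -/
theorem det_coe_ne_zero (g : GL (Fin 2) (ZMod q)) : (g : Matrix (Fin 2) (Fin 2) (ZMod q)).det ≠ 0 := by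
  rw [← Matrix.GeneralLinearGroup.val_det_apply]
  exact (Matrix.GeneralLinearGroup.det g).ne_zero

/-- a diagonal element of `GL₂(𝔽_q)` is `h(a d⁻¹)` times the scalar `d`. -/
theorem diag_decomp (t : GL (Fin 2) (ZMod q)) (h01 : (t : Matrix (Fin 2) (Fin 2) (ZMod q)) 0 1 = 0)
    (h10 : (t : Matrix (Fin 2) (Fin 2) (ZMod q)) 1 0 = 0) :
    ∃ c : (ZMod q)ˣ, (((diagU c)⁻¹ * t : GL (Fin 2) (ZMod q)) : Matrix (Fin 2) (Fin 2) (ZMod q)) 0 1 = 0 ∧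
      (((diagU c)⁻¹ * t : GL (Fin 2) (ZMod q)) : Matrix (Fin 2) (Fin 2) (ZMod q)) 1 0 = 0 ∧
      (((diagU c)⁻¹ * t : GL (Fin 2) (ZMod q)) : Matrix (Fin 2) (Fin 2) (ZMod q)) 0 0 =
        (((diagU c)⁻¹ * t : GL (Fin 2) (ZMod q)) : Matrix (Fin 2) (Fin 2) (ZMod q)) 1 1 := by
  have hdet := det_coe_ne_zero t
  rw [Matrix.det_fin_two, h01, zero_mul, sub_zero] at hdet
  have ha : (t : Matrix (Fin 2) (Fin 2) (ZMod q)) 0 0 ≠ 0 := left_ne_zero_of_mul hdet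
  have hd : (t : Matrix (Fin 2) (Fin 2) (ZMod q)) 1 1 ≠ 0 := right_ne_zero_of_mul hdet
  refine ⟨Units.mk0 _ ha * (Units.mk0 _ hd)⁻¹, ?_, ?_, ?_⟩ <;>
    rw [diagU_inv, Units.val_mul, coe_diagU] <;>
    simp [Matrix.mul_apply, Fin.sum_univ_two, h01, h10]
  field_simp

/-! ### §A.2 Fourier analysis along the unipotent radical `N ≅ ℤ∕q` -/

section Fourier

variable {W : Type*} [AddCommGroup W] [Module ℂ W] (ρ : Representation ℂ (GL (Fin 2) (ZMod q)) W)

/-- the standard additive character `x ↦ exp(2πi x ∕ q)` of `ℤ∕q`. -/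
def ψq : AddChar (ZMod q) ℂ := ZMod.stdAddChar (N := q)

/-- `ψq` is primitive. -/
theorem ψq_isPrimitive : (ψq (q := q)).IsPrimitive := ZMod.isPrimitive_stdAddChar q

/-- character sum: `Σ_x ψ(x b) = q·[b = 0]`. -/
theorem sum_ψq_mul (b : ZMod q) : ∑ x : ZMod q, ψq (x * b) = if b = 0 then (q : ℂ) else 0 := by
  rw [AddChar.sum_mulShift b ψq_isPrimitive, ZMod.card q]
  split_ifs <;> simp

/-- (q times) the `j`-th FOURIER PROJECTOR along `N`: `Φ_j = Σ_x ψ(−j x) ρ(n(x))`. -/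
def four (j : ZMod q) : W →ₗ[ℂ] W :=
  ∑ x : ZMod q, (ψq (-(j * x))) • ρ (upperUnip x)

/-- `Φ_j w = Σ_x ψ(−j x) ρ(n(x)) w`. -/
theorem four_apply (j : ZMod q) (w : W) : four ρ j w = ∑ x : ZMod q, ψq (-(j * x)) • ρ (upperUnip x) w := by
  simp [four, LinearMap.sum_apply, LinearMap.smul_apply]

/-- `N` acts on `Φ_j` through the character `ψ(j·)`: `ρ(n(y)) Φ_j w = ψ(j y) Φ_j w`. -/
theorem unip_four (y j : ZMod q) (w : W) : ρ (upperUnip y) (four ρ j w) = ψq (j * y) • four ρ j w := by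
  rw [four_apply, map_sum, Finset.smul_sum]
  have h1 : ∀ x : ZMod q, ρ (upperUnip y) (ψq (-(j * x)) • ρ (upperUnip x) w) = ψq (-(j * x)) • ρ (upperUnip (y + x)) w := by
    intro x
    rw [map_smul, ← Module.End.mul_apply, ← map_mul, upperUnip_mul]
  simp_rw [h1]
  rw [Fintype.sum_equiv (Equiv.addLeft y) (fun x : ZMod q => ψq (-(j * x)) • ρ (upperUnip (y + x)) w)
    (fun z : ZMod q => ψq (-(j * (z - y))) • ρ (upperUnip z) w)
    (fun x => by simp only [Equiv.coe_addLeft, add_sub_cancel_left])]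
  refine Finset.sum_congr rfl fun x _ => ?_
  rw [smul_smul, ← AddChar.map_add_eq_mul]
  congr 2
  ring

/-- orthogonality: `Φ_i Φ_j = q·[i = j]·Φ_j`. -/
theorem four_four (i j : ZMod q) (w : W) :
    four ρ i (four ρ j w) = if i = j then (q : ℂ) • four ρ j w else 0 := by
  rw [four_apply]
  simp_rw [unip_four, smul_smul, ← Finset.sum_smul]
  have hs : ∑ x : ZMod q, ψq (-(i * x)) * ψq (j * x) = ∑ x : ZMod q, ψq (x * (j - i)) := by
    refine Finset.sum_congr rfl fun x _ => ?_
    rw [← AddChar.map_add_eq_mul]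
    congr 1
    ring
  rw [hs, sum_ψq_mul]
  by_cases hij : i = j
  · subst hij; simp
  · have : j - i ≠ 0 := sub_ne_zero.mpr (Ne.symm hij)
    simp [this, hij]

/-- completeness: `Σ_j Φ_j w = q·w`. -/
theorem sum_four (w : W) : ∑ j : ZMod q, four ρ j w = (q : ℂ) • w := by
  simp_rw [four_apply]
  rw [Finset.sum_comm]
  simp_rw [← Finset.sum_smul]
  have hs : ∀ x : ZMod q, ∑ j : ZMod q, ψq (-(j * x)) = if x = 0 then (q : ℂ) else 0 := by
    intro x
    have : ∀ j : ZMod q, ψq (-(j * x)) = ψq (j * (-x)) := fun j => by rw [mul_neg]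
    simp_rw [this, sum_ψq_mul (-x), neg_eq_zero]
  simp_rw [hs]
  simp [Finset.sum_ite_eq', ite_smul, upperUnip_zero]

/-- the diagonal element `h(c)` permutes the projectors: `ρ(h(c)) Φ_j w = Φ_{j c⁻¹} ρ(h(c)) w`. -/
theorem diagU_four (c : (ZMod q)ˣ) (j : ZMod q) (w : W) :
    ρ (diagU c) (four ρ j w) = four ρ (j * ((c⁻¹ : (ZMod q)ˣ) : ZMod q)) (ρ (diagU c) w) := by
  rw [four_apply, four_apply, map_sum]
  have h1 : ∀ x : ZMod q, ρ (diagU c) (ψq (-(j * x)) • ρ (upperUnip x) w) =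
      ψq (-(j * x)) • ρ (upperUnip ((c : ZMod q) * x)) (ρ (diagU c) w) := by
    intro x
    rw [map_smul, ← Module.End.mul_apply, ← map_mul, diagU_mul_unip, map_mul, Module.End.mul_apply]
  simp_rw [h1]
  rw [← Equiv.sum_comp (Units.mulLeft c)
      (fun x : ZMod q => ψq (-(j * ((c⁻¹ : (ZMod q)ˣ) : ZMod q) * x)) • ρ (upperUnip x) (ρ (diagU c) w))]
  refine Finset.sum_congr rfl fun x _ => ?_
  simp only [Units.mulLeft_apply]
  congr 2
  rw [mul_assoc, ← mul_assoc ((c⁻¹ : (ZMod q)ˣ) : ZMod q), Units.inv_mul, one_mul]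

/-- in the other direction: `Φ_j ρ(h(c)) w = ρ(h(c)) Φ_{j c} w`. -/
theorem four_diagU (c : (ZMod q)ˣ) (j : ZMod q) (w : W) :
    four ρ j (ρ (diagU c) w) = ρ (diagU c) (four ρ (j * (c : ZMod q)) w) := by
  rw [diagU_four, mul_assoc, Units.mul_inv, mul_one]

/-! ### §A.3 UNIPOTENT RIGIDITY: a `G`-stable subspace with scalars acting trivially and no diagonal-torus-fixed vector is `N`-trivial -/

/-- **Lemma A (unipotent rigidity).** -/
theorem unip_trivial_of_noSplitFixed (W' : Submodule ℂ W)
    (hG : ∀ g : GL (Fin 2) (ZMod q), ∀ w ∈ W', ρ g w ∈ W')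
    (hZ : ∀ s : GL (Fin 2) (ZMod q), (s : Matrix (Fin 2) (Fin 2) (ZMod q)) 0 1 = 0 →
      (s : Matrix (Fin 2) (Fin 2) (ZMod q)) 1 0 = 0 →
      (s : Matrix (Fin 2) (Fin 2) (ZMod q)) 0 0 = (s : Matrix (Fin 2) (Fin 2) (ZMod q)) 1 1 → ∀ w ∈ W', ρ s w = w)
    (hno : ∀ v ∈ W', (∀ t : GL (Fin 2) (ZMod q), (t : Matrix (Fin 2) (Fin 2) (ZMod q)) 0 1 = 0 →
      (t : Matrix (Fin 2) (Fin 2) (ZMod q)) 1 0 = 0 → ρ t v = v) → v = 0) :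
    ∀ w ∈ W', ∀ x : ZMod q, ρ (upperUnip x) w = w := by
  intro w hw x
  have hq0 : (q : ℂ) ≠ 0 := by exact_mod_cast (Fact.out : q.Prime).ne_zero
  -- every Fourier component lies in `W'`
  have hmem : ∀ (j : ZMod q) (w' : W), w' ∈ W' → four ρ j w' ∈ W' := by
    intro j w' hw'
    rw [four_apply]
    exact Submodule.sum_mem _ fun x _ => Submodule.smul_mem _ _ (hG _ _ hw')
  -- the non-trivial Fourier components vanish
  have hkill : ∀ j : ZMod q, j ≠ 0 → four ρ j w = 0 := by
    intro j hj
    set wj := four ρ j w with hwj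
    have hwj_mem : wj ∈ W' := hmem j w hw
    -- the diagonal average of `wj`
    set v : W := ∑ c : (ZMod q)ˣ, ρ (diagU c) wj with hv
    have hv_mem : v ∈ W' := Submodule.sum_mem _ fun c _ => hG _ _ hwj_mem
    have hv_fix : ∀ t : GL (Fin 2) (ZMod q), (t : Matrix (Fin 2) (Fin 2) (ZMod q)) 0 1 = 0 →
        (t : Matrix (Fin 2) (Fin 2) (ZMod q)) 1 0 = 0 → ρ t v = v := by
      intro t h01 h10
      obtain ⟨c₀, hs01, hs10, hs00⟩ := diag_decomp t h01 h10
      have key : ∀ c : (ZMod q)ˣ, ρ t (ρ (diagU c) wj) = ρ (diagU (c₀ * c)) wj := by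
        intro c
        have ht : t = diagU c₀ * ((diagU c₀)⁻¹ * t) := by rw [mul_inv_cancel_left]
        rw [ht, map_mul, Module.End.mul_apply, hZ _ hs01 hs10 hs00 _ (hG _ _ hwj_mem), ← Module.End.mul_apply,
          ← map_mul, diagU_mul]
      rw [hv, map_sum]
      simp_rw [key]
      exact Equiv.sum_comp (Equiv.mulLeft c₀) (fun c : (ZMod q)ˣ => ρ (diagU c) wj)
    have hv0 : v = 0 := hno v hv_mem hv_fix
    -- apply `Φ_j` to the average: only `c = 1` survives
    have hcomp : four ρ j v = (q : ℂ) • wj := by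
      rw [hv, map_sum]
      have hterm : ∀ c : (ZMod q)ˣ, four ρ j (ρ (diagU c) wj) = if c = 1 then (q : ℂ) • wj else 0 := by
        intro c
        rw [four_diagU, hwj, four_four]
        by_cases hc : c = 1
        · subst hc; simp
        · have hne : j * (c : ZMod q) ≠ j := by
            intro h
            apply hc
            have h2 : (c : ZMod q) = 1 := by
              have := mul_right_eq_self₀.mp h
              exact this.resolve_right hj
            exact Units.val_eq_one.mp h2
          simp [hne, hc]
      simp_rw [hterm]
      simp [Finset.sum_ite_eq']
    rw [hv0, map_zero] at hcomp
    exact (smul_eq_zero.mp hcomp.symm).resolve_left hq0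
  -- so `w` is its own zeroth Fourier component, on which `N` acts trivially
  have hw0 : (q : ℂ) • w = four ρ 0 w := by
    rw [← sum_four ρ w, Finset.sum_eq_single (0 : ZMod q) (fun j _ hj => hkill j hj) (by simp)]
  have hw1 : w = (q : ℂ)⁻¹ • four ρ 0 w := by
    rw [← hw0, smul_smul, inv_mul_cancel₀ hq0, one_smul]
  rw [hw1, map_smul, unip_four, zero_mul, AddChar.map_zero_eq_one, one_smul]

/-! ### §A.4 NORMAL CLOSURE: the pointwise fixer of a `G`-stable subspace contains `SL₂(𝔽_q)` once it contains `N` -/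

/-- the subgroup of elements fixing the subspace `W'` pointwise. -/
def fixer (W' : Submodule ℂ W) : Subgroup (GL (Fin 2) (ZMod q)) where
  carrier := {g | ∀ w ∈ W', ρ g w = w}
  mul_mem' := by
    intro a b ha hb w hw
    rw [map_mul, Module.End.mul_apply, hb w hw, ha w hw]
  one_mem' := by
    intro w _
    rw [map_one, Module.End.one_apply]
  inv_mem' := by
    intro a ha w hw
    have h := ha w hw
    calc ρ a⁻¹ w = ρ a⁻¹ (ρ a w) := by rw [h]
      _ = w := by rw [← Module.End.mul_apply, ← map_mul, inv_mul_cancel, map_one, Module.End.one_apply]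

/-- membership in the fixer, unfolded. -/
theorem mem_fixer {W' : Submodule ℂ W} {g : GL (Fin 2) (ZMod q)} : g ∈ fixer ρ W' ↔ ∀ w ∈ W', ρ g w = w :=
  Iff.rfl

/-- the fixer of a `G`-stable subspace is normal. -/
theorem conj_mem_fixer {W' : Submodule ℂ W} (hG : ∀ g : GL (Fin 2) (ZMod q), ∀ w ∈ W', ρ g w ∈ W')
    {k : GL (Fin 2) (ZMod q)} (hk : k ∈ fixer ρ W') (g : GL (Fin 2) (ZMod q)) : g * k * g⁻¹ ∈ fixer ρ W' := by
  rw [mem_fixer] at hk ⊢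
  intro w hw
  rw [map_mul, map_mul, Module.End.mul_apply, Module.End.mul_apply, hk _ (hG _ _ hw), ← Module.End.mul_apply,
    ← map_mul, mul_inv_cancel, map_one, Module.End.one_apply]

/-- **Lemma B (normal closure of `N` is `SL₂`).** If every `n(x)` fixes the `G`-stable subspace `W'` pointwise, so does every
element of determinant one: `n⁻(x) = P n(x) P⁻¹`, and `g = n⁻(s) n(x) n⁻(c) n(y)` by the tree's `exists_unip_factorization`
(`CartanCover.Charext.InertHecke`, the four-unipotent factorisation of `SL₂` over a field). -/
theorem mem_fixer_of_det_one {W' : Submodule ℂ W} (hG : ∀ g : GL (Fin 2) (ZMod q), ∀ w ∈ W', ρ g w ∈ W')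
    (hN : ∀ x : ZMod q, upperUnip x ∈ fixer ρ W') (g : GL (Fin 2) (ZMod q))
    (hdet : (g : Matrix (Fin 2) (Fin 2) (ZMod q)).det = 1) : g ∈ fixer ρ W' := by
  have hL : ∀ x : ZMod q, lowerUnip x ∈ fixer ρ W' := fun x => by
    rw [lowp_eq_conj]
    exact conj_mem_fixer ρ hG (hN x) weylP
  obtain ⟨s, x, c, y, hg⟩ := exists_unip_factorization g hdet
  rw [hg]
  exact (fixer ρ W').mul_mem ((fixer ρ W').mul_mem ((fixer ρ W').mul_mem (hL s) (hN x)) (hL c)) (hN y)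

end Fourier

end FiniteGroup

end Summit.BirchSwinnertonDyer.BirchSwinnertonDyer.Theorems.CartanDoubleCoset

end
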